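import Summits.KontsevichZagierPeriods.KontsevichZagierPeriods.Theorems.HurwitzMicroSectorsHurwitzSectorComplementZetaEvenBKC
import Summits.KontsevichZagierPeriods.KontsevichZagierPeriods.Theorems.HurwitzMicroSectorsHurwitzSectorComplementStubLadderDescent
import Summits.KontsevichZagierPeriods.KontsevichZagierPeriods.Theorems.HurwitzMicroSectorsHurwitzSectorComplementStubLadderEngine
import Summits.KontsevichZagierPeriods.KontsevichZagierPeriods.Theorems.HurwitzMicroSectorsHurwitzSectorComplementStubArcSimplex
import Summits.KontsevichZagierPeriods.KontsevichZagierPeriods.Theorems.HurwitzMicroSectorsHurwitzSectorComplementStubBottomCell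

/-!
# `ZetaEvenBKC` (stmt-KontsevichZagierPeriods-3382, route CompiledSubstitutions), unconditionally

Euler's `ζ(2k) ∈ ℚ·π^{2k}` inside the Kontsevich–Zagier calculus for every `k ≥ 1`: the crux
`ZetaEvenBKC` of route CompiledSubstitutions, from the even-zeta descent of the Chebyshev ladder of
crux `HurwitzSectorComplement`, line `chebyshev-level-deformation` (`stub_ladderDescent`, conclusion (C),
composed from the landed ladder engine, arc simplices and bottom cell) and the level-2 bookkeeping
`zetaEvenBKC_of_descent`. References: F. Beukers, J. Kolk, E. Calabi (1993); M. Kontsevich,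
D. Zagier, *Periods* (2001), §1.2.
-/

noncomputable section

namespace Summit.KontsevichZagierPeriods.Theorems.CompiledSubstitutionsZetaEvenBKC

open Summit.KontsevichZagierPeriods.Theorems.HurwitzMicroSectorsHurwitzSectorComplement

/-- **`ZetaEvenBKC` holds**: for every `k ≥ 1` there is `q ∈ ℚ` with
`[(0,1)^{2k}, 1/(1 − ∏ xᵢ²)] ~ [(0,1)^{2k}, q ∏ 1/(1+xᵢ²)]`. [cite: KontsevichZagier2001, §1.2] -/
theorem zetaEvenBKC_proof :
    Summit.KontsevichZagierPeriods.KontsevichZagierPeriods.Theses.CompiledSubstitutions.ZetaEvenBKC :=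
  zetaEvenBKC_of_descent
    (stub_ladderDescent stub_ladderEngine stub_arcSimplex
      (stub_bottomCell stub_arcSimplex.1 stub_arcSimplex.2)).2.2.1

end Summit.KontsevichZagierPeriods.Theorems.CompiledSubstitutionsZetaEvenBKC

end
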